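import Literature.Probability.Percolation.MarkedLoopBoundarySpanDeterminant
import Literature.Probability.Percolation.MarkedLoopHexagonCensusA
import Literature.Probability.Percolation.MarkedLoopHexagonCensusB
import Literature.Probability.Percolation.MarkedLoopHexagonCensusC
import Literature.Probability.Percolation.MarkedLoopHexagonCensusD
import Literature.Probability.Percolation.MarkedLoopHexagonCensusE
import HarnessLib

/-!
# Boundary span at five marks («BSPAN-FIVE»): the census certificate on the unit hexagon

Topic `Literature/Probability/Percolation`; generic-`k` layer of the marked-loop (Khristoforov–Smirnov) lineage, THE FIRST INSTANCE of the lane's boundary-span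
statement: ★★★ `bSpan_five` — **`BSpan 5 a ∧ BNonvanish 5 a` on every arc `a`**: the boundary link-pattern laws of the home-arc mid-edges of all five-marked discrete
domains span Pearce–Rittenberg–de Gier–Nienhuis's planar Temperley–Lieb module of the hexagon (`LinkPattern 6 →₀ ℂ`, five link patterns), equivalently
(`MarkedLoopBoundarySpan.lean`, `MarkedLoopBoundaryLawModule.lean`) no non-zero solution of Khristoforov–Smirnov's tripod law at five disorders has a class-weighted
observable vanishing at every boundary mid-edge of an arc of every five-marked domain.

Proof = the census-certificate criterion `bSpan_of_det_lawLP_ne_zero'` of `MarkedLoopBoundarySpanDeterminant.lean` applied to the five home-arc lawpoints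
`zHexA, …, zHexE` of the seven-site hexagon `triBall 1` (`MarkedLoopHexagonLawpoints.lean`: two on `hexBall1Five`, one each on `hexBall1FiveW/NW/NE`) whose boundary
pattern counts on the five outermost patterns `outer₅` are the kernel censuses `patternCount_zHexA, …, patternCount_zHexE` (`MarkedLoopHexagonCensusA…E.lean`,
`2 · 2^6 = 128` configurations each):

  `N = [[26, 9, 15, 49, 29], [37, 18, 18, 37, 18], [33, 9, 13, 42, 31], [28, 13, 13, 51, 23], [33, 13, 9, 42, 31]]`, `det N = −226 304 ≠ 0`

(`hexCensusInt_det`, by `decide`); the matrix indexed by link patterns is the re-indexing of `N` along `Fin 5 ≃ Pat₀ 5 ≃ LinkPattern 6` (`outer₅`, `pat₀_five`,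
`pat₀EquivLinkPattern`, `lawLP_apply_pat₀`, `Matrix.det_reindex_self`).

* `hexCensusNat` / `hexCensusInt` / ★ `hexCensusInt_det` — the census matrix and its determinant;
* `finEquivPat₀Five : Fin 5 ≃ Pat₀ 5` (`outer₅` is a bijection, `MarkedLoopTripodBasisFive.lean`), `hexLawpoint : Fin 5 → Σ D, ArcPoint D (Fin.last 4)`, `hexLawpointLP`;
* ★ `patternCount_hexLawpoint` — the entries are the censuses; ★★ `det_lawLP_hexLawpointLP_ne_zero`;
* ★★★ `bSpan_five : ∀ a, BSpan 5 a ∧ BNonvanish 5 a`; ★★ `span_lawLP_five_eq_top` — the home-arc laws of five-marked domains span the link module.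

## References
* M. Khristoforov, S. Smirnov, *Percolation and O(1) loop model*, arXiv:2111.15612 (2021), §1.2 (arXiv v1 p. 2: the law of the link pattern), §2 Definition 3 and
  Lemma 4 (p. 4), eq. (4) and Remark 6 (p. 5: boundary values on the arcs; the `k = 3` boundary problem).
* P. A. Pearce, V. Rittenberg, J. de Gier, B. Nienhuis, *Temperley–Lieb stochastic processes*, J. Phys. A 35 (2002) L661–L668, §2 (the link-pattern module).
* B. Bollobás, O. Riordan, *Percolation*, Cambridge University Press (2006), Ch. 7 §7.2.2 (pp. 168–169, 191–195: marked discrete domains and their arcs).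

## Mathlib / tree
Tree: `MarkedLoopBoundarySpanDeterminant` (`bSpan_of_det_lawLP_ne_zero'`), `MarkedLoopBoundaryLawModule` (`lawLP`, `lawLP_apply_pat₀`, `bSpan_iff_span_lawLP`),
`MarkedLoopTemperleyLiebCoords` (`pat₀EquivLinkPattern`), `MarkedLoopTripodBasisFive` (`outer₅`, `outer₅_injective`, `pat₀_five`), `MarkedLoopHexagonLawpoints` (`zHexA…zHexE`),
`MarkedLoopHexagonCensusA…E` (`patternCount_zHexA…zHexE`). Mathlib: `Matrix.det_reindex_self`, `RingHom.map_det`, `Equiv.ofBijective`, `decide`.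
-/

open Finset

namespace Literature.Probability.Percolation.MarkedLoops

open Literature.Probability.Percolation Literature.Probability.LatticeModels
open Literature.Probability.LatticeModels.TemperleyLieb (LinkPattern)
open TriMarkedDomain

set_option maxRecDepth 400000

/-! ### The census matrix -/

/-- **the census matrix** of boundary pattern counts: rows = the lawpoints `zHexA, …, zHexE`, columns = the outermost patterns `outer₅`.
[cite: KhristoforovSmirnov2021, §1.2 (arXiv v1 p. 2: the law of the link pattern)] -/
def hexCensusNat : Fin 5 → Fin 5 → ℕ :=
  ![![26, 9, 15, 49, 29], ![37, 18, 18, 37, 18], ![33, 9, 13, 42, 31], ![28, 13, 13, 51, 23], ![33, 13, 9, 42, 31]]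

/-- the census matrix over `ℤ`. [cite: KhristoforovSmirnov2021, §1.2 (arXiv v1 p. 2)] -/
def hexCensusInt : Matrix (Fin 5) (Fin 5) ℤ := Matrix.of fun t q => (hexCensusNat t q : ℤ)

/-- ★ **the census matrix is non-singular**: `det = −226 304` (finite check). [cite: KhristoforovSmirnov2021, §2 eq. (4) and Remark 6 (arXiv v1 p. 5)] -/
theorem hexCensusInt_det : hexCensusInt.det = -226304 := by
  unfold hexCensusInt hexCensusNat
  decide

/-! ### The five lawpoints as a certificate family -/

/-- `Fin 5 ≃ Pat₀ 5` along the five outermost patterns `outer₅` (a bijection: `outer₅_injective`, `pat₀_five`).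
[cite: KhristoforovSmirnov2021, §1.2 (arXiv v1 p. 2: link patterns)] -/
noncomputable def finEquivPat₀Five : Fin 5 ≃ Pat₀ 5 :=
  Equiv.ofBijective outer₅ ⟨outer₅_injective, fun q => by obtain ⟨i, hi⟩ := pat₀_five q; exact ⟨i, hi.symm⟩⟩

/-- the equivalence evaluated. [cite: KhristoforovSmirnov2021, §1.2 (arXiv v1 p. 2)] -/
theorem finEquivPat₀Five_apply (q : Fin 5) : finEquivPat₀Five q = outer₅ q := rfl

/-- `Fin 5 ≃ LinkPattern 6`: the outermost patterns closed up (`pat₀EquivLinkPattern`). [cite: PearceRittenbergDeGierNienhuis2002, §2 (link patterns); KhristoforovSmirnov2021, §1.2 (arXiv v1 p. 2)] -/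
noncomputable def finEquivLinkPatternSix : Fin 5 ≃ LinkPattern (5 + 1) := finEquivPat₀Five.trans (pat₀EquivLinkPattern 5)

/-- **the five home-arc lawpoints** `zHexA, zHexB` (on `hexBall1Five`), `zHexC, zHexD, zHexE` (on `hexBall1FiveW/NW/NE`) as a family of pointed five-marked domains.
[cite: KhristoforovSmirnov2021, §2 eq. (4) and Remark 6 (arXiv v1 p. 5); BollobasRiordan2006, Ch. 7 §7.2.2 pp. 191–195] -/
noncomputable def hexLawpoint : Fin 5 → Σ D : TriMarkedDomain 5, ArcPoint D (Fin.last 4) :=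
  ![⟨hexBall1Five, zHexA⟩, ⟨hexBall1Five, zHexB⟩, ⟨hexBall1FiveW, zHexC⟩, ⟨hexBall1FiveNW, zHexD⟩, ⟨hexBall1FiveNE, zHexE⟩]

/-- ★ **the entries of the census matrix are the kernel censuses**: `N_{outer₅ q}(hexLawpoint t) = hexCensusNat t q`.
[cite: KhristoforovSmirnov2021, §1.2 (arXiv v1 p. 2: the law of the link pattern)] -/
theorem patternCount_hexLawpoint (t q : Fin 5) :
    patternCount (hexLawpoint t).1 (hexLawpoint t).2.v (hexLawpoint t).2.i (outer₅ q).1 = hexCensusNat t q := by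
  fin_cases t
  exacts [patternCount_zHexA q, patternCount_zHexB q, patternCount_zHexC q, patternCount_zHexD q, patternCount_zHexE q]

/-- the certificate family indexed by link patterns. [cite: KhristoforovSmirnov2021, §1.2 (arXiv v1 p. 2); PearceRittenbergDeGierNienhuis2002, §2] -/
noncomputable def hexLawpointLP (Q : LinkPattern (5 + 1)) : Σ D : TriMarkedDomain 5, ArcPoint D (Fin.last 4) := hexLawpoint (finEquivLinkPatternSix.symm Q)

/-- the boundary-law matrix of the lawpoints in the coordinates `Fin 5`: entry `(t, q)` = `lawLP (hexLawpoint t) (link pattern of outer₅ q)` = the census count.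
[cite: KhristoforovSmirnov2021, §1.2 (arXiv v1 p. 2)] -/
theorem lawLP_hexLawpoint (t q : Fin 5) : lawLP (hexLawpoint t).2 (finEquivLinkPatternSix q) = ((hexCensusInt t q : ℤ) : ℂ) := by
  have e : finEquivLinkPatternSix q = pat₀EquivLinkPattern 5 (outer₅ q) := rfl
  rw [e, lawLP_apply_pat₀, patternCount_hexLawpoint]
  unfold hexCensusInt
  rw [Matrix.of_apply, Int.cast_natCast]

/-- ★★ **the link-pattern-indexed boundary-law matrix of the five lawpoints is non-singular** (it is the re-indexed census matrix).
[cite: KhristoforovSmirnov2021, §2 eq. (4) and Remark 6 (arXiv v1 p. 5); PearceRittenbergDeGierNienhuis2002, §2] -/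
theorem det_lawLP_hexLawpointLP_ne_zero : (Matrix.of fun Q Q' : LinkPattern (5 + 1) => lawLP (hexLawpointLP Q).2 Q').det ≠ 0 := by
  set N : Matrix (Fin 5) (Fin 5) ℂ := Matrix.of fun t q => lawLP (hexLawpoint t).2 (finEquivLinkPatternSix q) with hN
  have hre : (Matrix.of fun Q Q' : LinkPattern (5 + 1) => lawLP (hexLawpointLP Q).2 Q') = Matrix.reindex finEquivLinkPatternSix finEquivLinkPatternSix N := by
    ext Q Q'
    rw [Matrix.reindex_apply, Matrix.submatrix_apply, Matrix.of_apply, hN, Matrix.of_apply, Equiv.apply_symm_apply]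
    rfl
  have hNI : N = (Int.castRingHom ℂ).mapMatrix hexCensusInt := by
    ext t q
    rw [hN, Matrix.of_apply, lawLP_hexLawpoint, RingHom.mapMatrix_apply, Matrix.map_apply]
    rfl
  rw [hre, Matrix.det_reindex_self, hNI, ← RingHom.map_det, hexCensusInt_det]
  norm_num

/-- ★★★ **BOUNDARY SPAN AT FIVE MARKS**: on every arc `a` of five-marked domains, the count vectors of the boundary mid-edges span (`BSpan 5 a`) and no non-zero
tripod-law solution has an observable vanishing there (`BNonvanish 5 a`) — the census certificate of the unit hexagon through `bSpan_of_det_lawLP_ne_zero'`.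
[cite: KhristoforovSmirnov2021, §2 eq. (4) and Remark 6 (arXiv v1 p. 5); PearceRittenbergDeGierNienhuis2002, §2; BollobasRiordan2006, Ch. 7 §7.2.2 pp. 191–195] -/
theorem bSpan_five (a : Fin 5) : BSpan 5 a ∧ BNonvanish 5 a :=
  bSpan_of_det_lawLP_ne_zero' (m := 1) hexLawpointLP det_lawLP_hexLawpointLP_ne_zero a

/-- ★★ hence **the home-arc boundary laws of five-marked domains span the planar Temperley–Lieb module of the hexagon** (`LinkPattern 6 →₀ ℂ`).
[cite: PearceRittenbergDeGierNienhuis2002, §2 (the link-pattern module); KhristoforovSmirnov2021, §1.2 (arXiv v1 p. 2)] -/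
theorem span_lawLP_five_eq_top :
    Submodule.span ℂ (Set.range fun zz : (Σ D : TriMarkedDomain (4 + 1), ArcPoint D (Fin.last 4)) => lawLP zz.2) = ⊤ :=
  (bSpan_iff_span_lawLP (m := 3) (Fin.last 4)).1 (bSpan_five (Fin.last 4)).1

end Literature.Probability.Percolation.MarkedLoops
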